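import Literature.Geometry.GaugeTheory.SeibergWittenInvariantModTwo
import HarnessLib

/-!
# The vector space of self-dual perturbations of the Seiberg–Witten equations (Čech form)

Topic `Literature/Geometry/GaugeTheory`; continues `SeibergWittenEquations` (`𝔰.Perturbation`: a
smooth real `2`-form on `X` whose coefficient matrix in every frame of the `Spin^c` structure `𝔰` is
self-dual) and `SeibergWittenInvariantModTwo` (extensionality, the `C^∞` topology on perturbations).

C. H. Taubes, *The Seiberg–Witten and Gromov invariants*, Math. Res. Lett. 2 (1995), §1, Fact 2:
"generic means a Baire subset of `C^∞(Λ₊)`" — the perturbations `µ` of (1.7) range over the real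
vector space `C^∞(Λ₊)` of smooth self-dual `2`-forms; J. W. Morgan, *The Seiberg–Witten Equations …*
(1996), §6.1: "for a generic `C^∞` self-dual real two-form `h` on `X`" (the parameter space of the
perturbed equations `(SW_h)` is the vector space `Ω²₊(X; ℝ)`).  Taubes's family of perturbations in
the symplectic case is an affine combination `µ = P₊F_{A₀} - (r/4)·ω` (Taubes 1995, (5.2)), which
needs exactly these operations.

PROVED here (0 named facts): `𝔰.Perturbation` is a real vector space under the pointwise operations on
the underlying forms (`Add`, `Neg`, `Sub`, `SMul ℝ`, `AddCommGroup`, `Module ℝ` — self-duality of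
the coefficient matrices is a linear condition, `hodgeStarTwo_add/smul/neg`, and smoothness of forms
is linear), with the `form` projections as `simp` lemmas and the coefficient matrices of sums /
multiples (`twoFormMatrix_add'`, `twoFormMatrix_smul'`).

## References

* C. H. Taubes, *The Seiberg–Witten and Gromov invariants*, Math. Res. Lett. 2 (1995) 221–238,
  §1 Fact 2, §5 (5.2). [Taubes1995]
* J. W. Morgan, *The Seiberg–Witten Equations and Applications to the Topology of Smooth
  Four-Manifolds*, Princeton Math. Notes 44 (1996), §6.1. [MorganSWBook1996]
-/

noncomputable section

open scoped Manifold ContDiff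
open Literature.Geometry.Lorentzian (PseudoRiemannianMetric)
open Literature.Topology.FourManifolds (SmoothOrientation)
open Literature.Geometry.Kaehler (MForm IsSmoothForm)

namespace Literature.Geometry.GaugeTheory

/-- Local notation: the model space `ℝ⁴`. -/
local notation "𝔼⁴" => EuclideanSpace ℝ (Fin 4)

section Forms

variable {X : Type*} [TopologicalSpace X] [ChartedSpace 𝔼⁴ X]

/-- The coefficient matrix of a sum of `2`-forms is the sum of the coefficient matrices. [folklore] -/
theorem twoFormMatrix_add' (θ θ' : MForm (𝓡 4) X ℝ 2) (x : X) (e : Fin 4 → TangentSpace (𝓡 4) x) :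
    twoFormMatrix (θ + θ') x e = twoFormMatrix θ x e + twoFormMatrix θ' x e :=
  Matrix.ext fun _ _ ↦ rfl

/-- The coefficient matrix of a real multiple of a `2`-form. [folklore] -/
theorem twoFormMatrix_smul' (c : ℝ) (θ : MForm (𝓡 4) X ℝ 2) (x : X) (e : Fin 4 → TangentSpace (𝓡 4) x) :
    twoFormMatrix (c • θ) x e = c • twoFormMatrix θ x e :=
  Matrix.ext fun _ _ ↦ rfl

/-- The coefficient matrix of the negative of a `2`-form. [folklore] -/
theorem twoFormMatrix_neg' (θ : MForm (𝓡 4) X ℝ 2) (x : X) (e : Fin 4 → TangentSpace (𝓡 4) x) :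
    twoFormMatrix (-θ) x e = -twoFormMatrix θ x e :=
  Matrix.ext fun _ _ ↦ rfl

end Forms

/-- Self-duality is additive. [cite: MorganSWBook1996, Lemma 2.3.4] -/
theorem IsSelfDualTwo.add {A B : Matrix (Fin 4) (Fin 4) ℝ} (hA : IsSelfDualTwo A) (hB : IsSelfDualTwo B) :
    IsSelfDualTwo (A + B) := by
  unfold IsSelfDualTwo at *
  rw [hodgeStarTwo_add, hA, hB]

/-- Self-duality is homogeneous. [cite: MorganSWBook1996, Lemma 2.3.4] -/
theorem IsSelfDualTwo.smul (c : ℝ) {A : Matrix (Fin 4) (Fin 4) ℝ} (hA : IsSelfDualTwo A) :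
    IsSelfDualTwo (c • A) := by
  unfold IsSelfDualTwo at *
  rw [hodgeStarTwo_smul, hA]

/-- Self-duality is preserved by negation. [cite: MorganSWBook1996, Lemma 2.3.4] -/
theorem IsSelfDualTwo.neg {A : Matrix (Fin 4) (Fin 4) ℝ} (hA : IsSelfDualTwo A) : IsSelfDualTwo (-A) := by
  unfold IsSelfDualTwo at *
  rw [hodgeStarTwo_neg, hA]

variable {X : Type*} [TopologicalSpace X] [ChartedSpace 𝔼⁴ X] [IsManifold (𝓡 4) ∞ X]
  {g : PseudoRiemannianMetric (𝓡 4) ∞ 𝔼⁴ (TangentSpace (𝓡 4) : X → Type _)}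
  {o : SmoothOrientation (𝓡 4) X} {ι : Type*} {𝔰 : SpincStructure g o ι}

namespace SpincStructure.Perturbation

/-- **Sum of perturbations** (`C^∞(Λ₊)` is closed under addition). [cite: Taubes1995, §1 Fact 2] -/
instance instAdd : Add 𝔰.Perturbation :=
  ⟨fun η η' ↦ ⟨η.form + η'.form, η.isSmoothForm.add η'.isSmoothForm, fun i x hx ↦ by
    rw [twoFormMatrix_add']; exact IsSelfDualTwo.add (η.isSelfDual i x hx) (η'.isSelfDual i x hx)⟩⟩

/-- **Negative of a perturbation.** [cite: Taubes1995, §1 Fact 2] -/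
instance instNeg : Neg 𝔰.Perturbation :=
  ⟨fun η ↦ ⟨-η.form, by simpa using η.isSmoothForm.smul (-1), fun i x hx ↦ by
    rw [twoFormMatrix_neg']; exact IsSelfDualTwo.neg (η.isSelfDual i x hx)⟩⟩

/-- **Difference of perturbations.** [cite: Taubes1995, §1 Fact 2] -/
instance instSub : Sub 𝔰.Perturbation :=
  ⟨fun η η' ↦ ⟨η.form - η'.form, by simpa [sub_eq_add_neg] using η.isSmoothForm.add (η'.isSmoothForm.smul (-1)),
    fun i x hx ↦ by
      rw [sub_eq_add_neg, twoFormMatrix_add', twoFormMatrix_neg']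
      exact IsSelfDualTwo.add (η.isSelfDual i x hx) (IsSelfDualTwo.neg (η'.isSelfDual i x hx))⟩⟩

/-- **Real multiples of a perturbation.** [cite: Taubes1995, §1 Fact 2] -/
instance instSMul : SMul ℝ 𝔰.Perturbation :=
  ⟨fun c η ↦ ⟨c • η.form, η.isSmoothForm.smul c, fun i x hx ↦ by
    rw [twoFormMatrix_smul']; exact IsSelfDualTwo.smul c (η.isSelfDual i x hx)⟩⟩

/-- Natural multiples of a perturbation (through the real ones). [folklore] -/
instance instSMulNat : SMul ℕ 𝔰.Perturbation :=
  ⟨fun n η ↦ (n : ℝ) • η⟩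

/-- Integer multiples of a perturbation (through the real ones). [folklore] -/
instance instSMulInt : SMul ℤ 𝔰.Perturbation :=
  ⟨fun n η ↦ (n : ℝ) • η⟩

/-- The form of a sum (definitional). [folklore] -/
@[simp] theorem add_form (η η' : 𝔰.Perturbation) : (η + η').form = η.form + η'.form := rfl

/-- The form of a negative (definitional). [folklore] -/
@[simp] theorem neg_form (η : 𝔰.Perturbation) : (-η).form = -η.form := rfl

/-- The form of a difference (definitional). [folklore] -/
@[simp] theorem sub_form (η η' : 𝔰.Perturbation) : (η - η').form = η.form - η'.form := rfl

/-- The form of a multiple (definitional). [folklore] -/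
@[simp] theorem smul_form (c : ℝ) (η : 𝔰.Perturbation) : (c • η).form = c • η.form := rfl

/-- **`C^∞(Λ₊)` is an additive commutative group** (transported from the forms along the injective
projection `form`). [cite: Taubes1995, §1 Fact 2] -/
instance instAddCommGroup : AddCommGroup 𝔰.Perturbation :=
  Function.Injective.addCommGroup Perturbation.form (fun _ _ h ↦ Perturbation.ext h) rfl (fun _ _ ↦ rfl)
    (fun _ ↦ rfl) (fun _ _ ↦ rfl)
    (fun η n ↦ by change ((n : ℝ) • η).form = n • η.form; rw [smul_form, Nat.cast_smul_eq_nsmul])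
    (fun η n ↦ by change ((n : ℝ) • η).form = n • η.form; rw [smul_form, Int.cast_smul_eq_zsmul])

/-- **`C^∞(Λ₊)` is a real vector space.** [cite: Taubes1995, §1 Fact 2] -/
instance instModule : Module ℝ 𝔰.Perturbation :=
  Function.Injective.module ℝ (AddMonoidHom.mk' Perturbation.form fun _ _ ↦ rfl)
    (fun _ _ h ↦ Perturbation.ext h) (fun _ _ ↦ rfl)

/-- The coefficient matrix of a sum of perturbations in a frame. [folklore] -/
theorem twoFormMatrix_add (η η' : 𝔰.Perturbation) (x : X) (e : Fin 4 → TangentSpace (𝓡 4) x) :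
    twoFormMatrix (η + η').form x e = twoFormMatrix η.form x e + twoFormMatrix η'.form x e :=
  twoFormMatrix_add' _ _ x e

/-- The coefficient matrix of a difference of perturbations in a frame. [folklore] -/
theorem twoFormMatrix_sub (η η' : 𝔰.Perturbation) (x : X) (e : Fin 4 → TangentSpace (𝓡 4) x) :
    twoFormMatrix (η - η').form x e = twoFormMatrix η.form x e - twoFormMatrix η'.form x e := by
  rw [sub_form, sub_eq_add_neg, twoFormMatrix_add', twoFormMatrix_neg', sub_eq_add_neg]

/-- The coefficient matrix of a multiple of a perturbation in a frame. [folklore] -/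
theorem twoFormMatrix_smul (c : ℝ) (η : 𝔰.Perturbation) (x : X) (e : Fin 4 → TangentSpace (𝓡 4) x) :
    twoFormMatrix (c • η).form x e = c • twoFormMatrix η.form x e :=
  twoFormMatrix_smul' c _ x e

/-- `ρ⁺` of a difference of perturbations. [cite: MorganSWBook1996, Lemma 2.3.4] -/
theorem plusAction_twoFormMatrix_sub (η η' : 𝔰.Perturbation) (x : X) (e : Fin 4 → TangentSpace (𝓡 4) x) :
    plusAction (twoFormMatrix (η - η').form x e) =
      plusAction (twoFormMatrix η.form x e) - plusAction (twoFormMatrix η'.form x e) := by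
  rw [twoFormMatrix_sub, sub_eq_add_neg, plusAction_add, ← neg_one_smul ℝ (twoFormMatrix η'.form x e),
    plusAction_smul]
  simp [sub_eq_add_neg]

/-- `ρ⁺` of a multiple of a perturbation. [cite: MorganSWBook1996, Lemma 2.3.4] -/
theorem plusAction_twoFormMatrix_smul (c : ℝ) (η : 𝔰.Perturbation) (x : X) (e : Fin 4 → TangentSpace (𝓡 4) x) :
    plusAction (twoFormMatrix (c • η).form x e) = (c : ℂ) • plusAction (twoFormMatrix η.form x e) := by
  rw [twoFormMatrix_smul, plusAction_smul]

end SpincStructure.Perturbation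

end Literature.Geometry.GaugeTheory

end
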